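import Mathlib
import Summits.KontsevichZagierPeriods.Zeta5Search.TypeSpaceAggregateOrigin
import Summits.KontsevichZagierPeriods.Zeta5Search.TypeSpaceLawZeroFinal
import HarnessLib

/-!
# ζ(5) search — the type-space law, ORIGIN regime, TWO-SIDED form: `v_p(Cas_j(b)) ≥ 5 − 2M = casLB + 2`

HONEST FRAMING: systematic search; no irrationality claim unless certified.

Cell `pub-zeta5`, prover seat p3 (gen 2).  REPORT-gen2-g11 §4 THEOREM W (O), proved here in the form whose parallelism hypothesis
(differences of the doubled orbit points `∥ u` mod `p`) is assumed for `b` AND for `b + e_j` (`typeSpaceLawOrigin_twoSided`); the class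
hypotheses (pole classes `E ≥ −M`, classes of exponent `−M` centre-free with EXACT first-order orbit vector `σ_x − σ_x̄ ∥ u`) are assumed
for `b` only and transported.  Inputs: `aggregateOrigin` (p3, on typer g11's machinery) for `b` and `b + e_j`, the residue congruences
`‖Res₀‖ ≤ p⁻¹` from THEOREM R (`ResidueLaw.res0_padicNorm_le`), and the determinant expansion
`w'v − wv' = α'(u₁e₂ − u₂e₁) − α(u₁e₂' − u₂e₁') + (e₁'e₂ − e₁e₂')` for `(w, v) = α·u + e`, `(w', v') = α'·u + e'`, `‖e‖ ≤ p⁻¹`,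
`‖u₁e₂ − u₂e₁‖ ≤ p⁻²`.  The tree statement `ResidueLaw.TypeSpaceLawOrigin` (parallelism assumed for `b` only) needs in addition the
transport of the orbit points through a HIT deep orbit, i.e. a raise-pair lemma for NON-palindromic types (open; the zero-regime
`point_transfer` uses `typeW/V_raise_pair`, which assumes a palindromic type).  Census use: check the hypotheses on `b(n)` and `b(n) + e₇`.
`p`-adic valuations of rational numbers; nothing here bears on irrationality.
-/

noncomputable section

open Finset

namespace Summit.KontsevichZagierPeriods.Zeta5Search.SecondOrder

open Summit.KontsevichZagierPeriods.Zeta5Search.DualSeries (InBox)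
open Summit.KontsevichZagierPeriods.Zeta5Search.WedgeDictionary (coeffW coeffV)
open Summit.KontsevichZagierPeriods.Zeta5Search.CasoratianValuation (InPolytope shift casoratian)
open Summit.KontsevichZagierPeriods.Zeta5Search.ClusterValuation
open Summit.KontsevichZagierPeriods.Zeta5Search.PadicSeries
open Summit.KontsevichZagierPeriods.Zeta5Search.BigPrime (shift_zero dOf_shift)
open Summit.KontsevichZagierPeriods.Zeta5Search.ResidueLaw (pointW pointV liveClasses dirDet res0_padicNorm_le sum_classExp_range)

variable {p : ℕ} [hp : Fact p.Prime]

/-- The 2×2 determinant of two vectors that are parallel to `u` up to small errors is small: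
`(α'u₁ + e₁')(αu₂ + e₂) − (αu₁ + e₁)(α'u₂ + e₂') = α'(u₁e₂ − u₂e₁) − α(u₁e₂' − u₂e₁') + (e₁'e₂ − e₁e₂')`. -/
theorem det_parallel_small {α α' u₁ u₂ e₁ e₂ e₁' e₂' : ℚ} (hα : padicNorm p α ≤ 1) (hα' : padicNorm p α' ≤ 1)
    (he₁ : padicNorm p e₁ ≤ (p : ℚ) ^ (-(1 : ℤ))) (he₂ : padicNorm p e₂ ≤ (p : ℚ) ^ (-(1 : ℤ)))
    (he₁' : padicNorm p e₁' ≤ (p : ℚ) ^ (-(1 : ℤ))) (he₂' : padicNorm p e₂' ≤ (p : ℚ) ^ (-(1 : ℤ)))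
    (hd : padicNorm p (u₁ * e₂ - u₂ * e₁) ≤ (p : ℚ) ^ (-(2 : ℤ)))
    (hd' : padicNorm p (u₁ * e₂' - u₂ * e₁') ≤ (p : ℚ) ^ (-(2 : ℤ))) :
    padicNorm p ((α' * u₁ + e₁') * (α * u₂ + e₂) - (α * u₁ + e₁) * (α' * u₂ + e₂')) ≤ (p : ℚ) ^ (-(2 : ℤ)) := by
  have hp0 : (p : ℚ) ≠ 0 := Nat.cast_ne_zero.2 hp.out.ne_zero
  have h11 : (p : ℚ) ^ (-(1 : ℤ)) * (p : ℚ) ^ (-(1 : ℤ)) = (p : ℚ) ^ (-(2 : ℤ)) := by rw [← zpow_add₀ hp0]; norm_num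
  have e : (α' * u₁ + e₁') * (α * u₂ + e₂) - (α * u₁ + e₁) * (α' * u₂ + e₂')
      = α' * (u₁ * e₂ - u₂ * e₁) + (-(α * (u₁ * e₂' - u₂ * e₁')) + (e₁' * e₂ - e₁ * e₂')) := by ring
  rw [e]
  refine (padicNorm.nonarchimedean (p := p)).trans (max_le ?_ ((padicNorm.nonarchimedean (p := p)).trans (max_le ?_ ?_)))
  · rw [padicNorm.mul]
    calc _ ≤ (1 : ℚ) * (p : ℚ) ^ (-(2 : ℤ)) := mul_le_mul hα' hd (padicNorm.nonneg _) zero_le_one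
      _ = _ := one_mul _
  · rw [padicNorm.neg, padicNorm.mul]
    calc _ ≤ (1 : ℚ) * (p : ℚ) ^ (-(2 : ℤ)) := mul_le_mul hα hd' (padicNorm.nonneg _) zero_le_one
      _ = _ := one_mul _
  · refine (padicNorm.sub (p := p)).trans (max_le ?_ ?_)
    · rw [padicNorm.mul, ← h11]; exact mul_le_mul he₁' he₂ (padicNorm.nonneg _) (zpow_p_nonneg _)
    · rw [padicNorm.mul, ← h11]; exact mul_le_mul he₁ he₂' (padicNorm.nonneg _) (zpow_p_nonneg _)

section Origin

variable (b : ℕ → ℤ) {j : ℕ} (hb : InPolytope b) (hb' : InPolytope (shift b j)) (hj1 : 1 ≤ j) (hj7 : j ≤ 7)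
  (hp5 : 5 ≤ p) (hpb : (p : ℤ) ≤ b 0) (hwin : (b 0 + 2 : ℤ) < (p : ℤ) ^ 2) {M : ℕ} (hM : 6 ≤ M) (hMe : Even M) (u : ℤ × ℤ)
  (hu : ¬ ((p : ℤ) ∣ u.1 ∧ (p : ℤ) ∣ u.2))
  (G1 : ∀ x, x < p → 1 ≤ classPoleCount b p x → -(M : ℤ) ≤ classExp b p x)
  (G3o : ∀ x, x < p → 1 ≤ classPoleCount b p x → classExp b p x = -(M : ℤ) →
    ¬ CentreIn b p x ∧
    (u.1 : ℚ) * (vHat b p x - vHat b p (conjClass b p x)) - (u.2 : ℚ) * (wHat b p x - wHat b p (conjClass b p x)) = 0)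
include hb hb' hj1 hj7 hp5 hpb hwin hM hMe hu G1 G3o

omit hb hb' hj1 hj7 hpb hwin G1 G3o in
/-- **One parameter vector**: from `aggregateOrigin`, the residue congruence and the parallelism of the point differences,
`(W/(−p)^{3−M}, V/(−p)^{−M}) = α·u + e` with `‖α‖ ≤ 1`, `‖e‖ ≤ p⁻¹`, `‖u₁e₂ − u₂e₁‖ ≤ p⁻²`. -/
theorem origin_decomposition (c₀ : ℕ → ℤ) (hc₀ : InPolytope c₀) (hpc : (p : ℤ) ≤ c₀ 0) (hwc : (c₀ 0 + 2 : ℤ) < (p : ℤ) ^ 2)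
    (F1 : ∀ x, x < p → 1 ≤ classPoleCount c₀ p x → -(M : ℤ) ≤ classExp c₀ p x)
    (F3 : ∀ x, x < p → 1 ≤ classPoleCount c₀ p x → classExp c₀ p x = -(M : ℤ) →
      ¬ CentreIn c₀ p x ∧
      (u.1 : ℚ) * (vHat c₀ p x - vHat c₀ p (conjClass c₀ p x)) - (u.2 : ℚ) * (wHat c₀ p x - wHat c₀ p (conjClass c₀ p x)) = 0)
    (HD : ∀ x ∈ liveClasses c₀ p M, ∀ y ∈ liveClasses c₀ p M,
      dirDet c₀ p M u x y = 0 ∨ 1 ≤ padicValRat p (dirDet c₀ p M u x y))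
    (hres : padicNorm p
      ((∑ z ∈ (range p).filter (fun x => 1 ≤ classPoleCount c₀ p x ∧ classExp c₀ p x = -(M : ℤ)), gHat c₀ p z * phiHat c₀ p z)
        + ∑ z ∈ (range p).filter (fun x => 1 ≤ classPoleCount c₀ p x ∧ classExp c₀ p x = -(M : ℤ) + 1), gHat c₀ p z)
      ≤ (p : ℚ) ^ (-(1 : ℤ))) :
    ∃ α e₁ e₂ : ℚ, padicNorm p α ≤ 1 ∧ padicNorm p e₁ ≤ (p : ℚ) ^ (-(1 : ℤ)) ∧ padicNorm p e₂ ≤ (p : ℚ) ^ (-(1 : ℤ)) ∧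
      padicNorm p ((u.1 : ℚ) * e₂ - (u.2 : ℚ) * e₁) ≤ (p : ℚ) ^ (-(2 : ℤ)) ∧
      coeffW c₀ / (-(p : ℚ)) ^ (-(M : ℤ) + 3) = α * u.1 + e₁ ∧ coeffV c₀ / (-(p : ℚ)) ^ (-(M : ℤ)) = α * u.2 + e₂ := by
  have hp0 : (p : ℚ) ≠ 0 := Nat.cast_ne_zero.2 hp.out.ne_zero
  have hp2 : p ≠ 2 := by omega
  have h0 : 0 ≤ c₀ 0 := hc₀.1.1
  obtain ⟨-, -, -, hn⟩ := thmA_data c₀ hc₀ hwc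
  have h4n : padicNorm p (4 : ℚ) = 1 := by
    rw [show (4 : ℚ) = 2 * 2 by norm_num, padicNorm.mul, padicNorm_two hp2, one_mul]
  have hpn1 : padicNorm p (p : ℚ) = (p : ℚ) ^ (-(1 : ℤ)) := CellA.padicNorm_p
  obtain ⟨X, Y, c, k, hX1, hY1, hc1, hcL, hW, hV, hk1, hkL, hksum, hXa, hYa⟩ :=
    aggregateOrigin c₀ hc₀ hp5 hpc hwc hM hMe F1 (fun x hx h1 hE => (F3 x hx h1 hE).1)
  set AW := ∑ z ∈ range p, c z * (wHat c₀ p z - wHat c₀ p (conjClass c₀ p z)) with hAW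
  set AV := ∑ z ∈ range p, c z * (vHat c₀ p z - vHat c₀ p (conjClass c₀ p z)) with hAV
  -- `A ∥ u` exactly
  have hpar : (u.1 : ℚ) * AV - (u.2 : ℚ) * AW = 0 := by
    rw [hAW, hAV, Finset.mul_sum, Finset.mul_sum, ← sum_sub_distrib]
    refine sum_eq_zero fun z _ => ?_
    by_cases hz : c z = 0
    · rw [hz]; ring
    · obtain ⟨hzp, h1, hE⟩ := hcL z hz
      have h := (F3 z hzp h1 hE).2
      have e : (u.1 : ℚ) * (c z * (vHat c₀ p z - vHat c₀ p (conjClass c₀ p z)))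
          - (u.2 : ℚ) * (c z * (wHat c₀ p z - wHat c₀ p (conjClass c₀ p z)))
          = c z * ((u.1 : ℚ) * (vHat c₀ p z - vHat c₀ p (conjClass c₀ p z))
            - (u.2 : ℚ) * (wHat c₀ p z - wHat c₀ p (conjClass c₀ p z))) := by ring
      rw [e, h, mul_zero]
  have hAW1 : padicNorm p AW ≤ 1 := by
    refine padicNorm.sum_le' (fun z _ => ?_) zero_le_one
    rw [padicNorm.mul]
    calc _ ≤ (1 : ℚ) * 1 := mul_le_mul (hc1 z) ((padicNorm.sub (p := p)).trans (max_le
          (LevelClass.padicNorm_wHat_le_one c₀ h0 hn hp2 _) (LevelClass.padicNorm_wHat_le_one c₀ h0 hn hp2 _)))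
          (padicNorm.nonneg _) zero_le_one
      _ = 1 := one_mul _
  have hAV1 : padicNorm p AV ≤ 1 := by
    refine padicNorm.sum_le' (fun z _ => ?_) zero_le_one
    rw [padicNorm.mul]
    calc _ ≤ (1 : ℚ) * 1 := mul_le_mul (hc1 z) ((padicNorm.sub (p := p)).trans (max_le
          (LevelClass.padicNorm_vHat_le_one c₀ h0 hn hp2) (LevelClass.padicNorm_vHat_le_one c₀ h0 hn hp2)))
          (padicNorm.nonneg _) zero_le_one
      _ = 1 := one_mul _
  -- the weight sum is `O(p)`
  have hsum : padicNorm p (∑ z ∈ range p, k z) ≤ (p : ℚ) ^ (-(1 : ℤ)) := by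
    have e : ∑ z ∈ range p, k z = (4 * ∑ z ∈ range p, k z) / 4 := by ring
    rw [e, padicNorm.div, h4n, div_one, hksum]; exact hres
  -- `u₁Y − u₂X ≡ Σ k_z·dirDet(x₀, z) ≡ 0 (mod p)`
  obtain ⟨x₀, hx₀⟩ : ∃ x₀, ∀ z ∈ liveClasses c₀ p M, x₀ ∈ liveClasses c₀ p M := by
    by_cases h : (liveClasses c₀ p M).Nonempty
    · obtain ⟨x, hx⟩ := h; exact ⟨x, fun _ _ => hx⟩
    · exact ⟨0, fun z hz => absurd ⟨z, hz⟩ h⟩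
  have hP0 := padicNorm_point_le_one c₀ h0 hn hp2 M x₀
  have hu1 : padicNorm p (u.1 : ℚ) ≤ 1 := padicNorm.of_int _
  have hu2 : padicNorm p (u.2 : ℚ) ≤ 1 := padicNorm.of_int _
  have hXY : padicNorm p ((u.1 : ℚ) * Y - (u.2 : ℚ) * X) ≤ (p : ℚ) ^ (-(1 : ℤ)) := by
    have e : (u.1 : ℚ) * Y - (u.2 : ℚ) * X
        = ((u.1 : ℚ) * (Y - ∑ z ∈ range p, k z * pointV c₀ p M z) - (u.2 : ℚ) * (X - ∑ z ∈ range p, k z * pointW c₀ p M z))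
          + (∑ z ∈ range p, k z * dirDet c₀ p M u x₀ z)
          + (∑ z ∈ range p, k z) * ((u.1 : ℚ) * pointV c₀ p M x₀ - (u.2 : ℚ) * pointW c₀ p M x₀) := by
      have h1 : ∑ z ∈ range p, k z * dirDet c₀ p M u x₀ z
          = (u.1 : ℚ) * (∑ z ∈ range p, k z * pointV c₀ p M z) - (u.2 : ℚ) * (∑ z ∈ range p, k z * pointW c₀ p M z)
            - (∑ z ∈ range p, k z) * ((u.1 : ℚ) * pointV c₀ p M x₀ - (u.2 : ℚ) * pointW c₀ p M x₀) := by
        rw [Finset.mul_sum, Finset.mul_sum, Finset.sum_mul, ← sum_sub_distrib, ← sum_sub_distrib]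
        exact sum_congr rfl fun z _ => by unfold dirDet; ring
      rw [h1]; ring
    rw [e]
    refine (padicNorm.nonarchimedean (p := p)).trans (max_le ((padicNorm.nonarchimedean (p := p)).trans (max_le ?_ ?_)) ?_)
    · refine (padicNorm.sub (p := p)).trans (max_le ?_ ?_)
      · rw [padicNorm.mul]
        calc _ ≤ (1 : ℚ) * (p : ℚ) ^ (-(1 : ℤ)) := mul_le_mul hu1 hYa (padicNorm.nonneg _) zero_le_one
          _ = _ := one_mul _
      · rw [padicNorm.mul]
        calc _ ≤ (1 : ℚ) * (p : ℚ) ^ (-(1 : ℤ)) := mul_le_mul hu2 hXa (padicNorm.nonneg _) zero_le_one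
          _ = _ := one_mul _
    · refine padicNorm.sum_le' (fun z _ => ?_) (zpow_p_nonneg _)
      by_cases hz : k z = 0
      · rw [hz, zero_mul, padicNorm.zero]; exact zpow_p_nonneg _
      · have hzL := hkL z hz
        rw [padicNorm.mul]
        calc _ ≤ (1 : ℚ) * (p : ℚ) ^ (-(1 : ℤ)) :=
              mul_le_mul (hk1 z) (padicNorm_le_of_zero_or_val (HD x₀ (hx₀ z hzL) z hzL)) (padicNorm.nonneg _) zero_le_one
          _ = _ := one_mul _
    · rw [padicNorm.mul]
      have hin : padicNorm p ((u.1 : ℚ) * pointV c₀ p M x₀ - (u.2 : ℚ) * pointW c₀ p M x₀) ≤ 1 := by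
        refine (padicNorm.sub (p := p)).trans (max_le ?_ ?_)
        · rw [padicNorm.mul]
          calc _ ≤ (1 : ℚ) * 1 := mul_le_mul hu1 hP0.2 (padicNorm.nonneg _) zero_le_one
            _ = 1 := one_mul _
        · rw [padicNorm.mul]
          calc _ ≤ (1 : ℚ) * 1 := mul_le_mul hu2 hP0.1 (padicNorm.nonneg _) zero_le_one
            _ = 1 := one_mul _
      calc _ ≤ (p : ℚ) ^ (-(1 : ℤ)) * 1 := mul_le_mul hsum hin (padicNorm.nonneg _) (zpow_p_nonneg _)
        _ = _ := mul_one _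
  -- the decomposition
  set w := coeffW c₀ / (-(p : ℚ)) ^ (-(M : ℤ) + 3) with hw
  set v := coeffV c₀ / (-(p : ℚ)) ^ (-(M : ℤ)) with hv
  -- choose `α` from the coordinate of `u` that is a `p`-unit
  have hcase : ∃ α : ℚ, padicNorm p α ≤ 1 ∧ AW = α * u.1 ∧ AV = α * u.2 := by
    by_cases h1 : (p : ℤ) ∣ u.1
    · have h2 : ¬ (p : ℤ) ∣ u.2 := fun h => hu ⟨h1, h⟩
      have hu20 : (u.2 : ℚ) ≠ 0 := by
        have : u.2 ≠ 0 := fun h => h2 (by rw [h]; exact dvd_zero _)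
        exact_mod_cast this
      refine ⟨AV / u.2, ?_, ?_, (div_mul_cancel₀ _ hu20).symm⟩
      · rw [padicNorm.div, (padicNorm.int_eq_one_iff (p := p) u.2).2 h2, div_one]; exact hAV1
      · field_simp; linear_combination -hpar
    · have hu10 : (u.1 : ℚ) ≠ 0 := by
        have : u.1 ≠ 0 := fun h => h1 (by rw [h]; exact dvd_zero _)
        exact_mod_cast this
      refine ⟨AW / u.1, ?_, (div_mul_cancel₀ _ hu10).symm, ?_⟩
      · rw [padicNorm.div, (padicNorm.int_eq_one_iff (p := p) u.1).2 h1, div_one]; exact hAW1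
      · field_simp; linear_combination hpar
  obtain ⟨α, hα1, hαW, hαV⟩ := hcase
  refine ⟨α, w - AW, v - AV, hα1, ?_, ?_, ?_, by rw [hαW]; ring, by rw [hαV]; ring⟩
  · -- `‖w − A_W‖ ≤ p⁻¹`
    have e : w - AW = (w - AW + (p : ℚ) * X) + (-((p : ℚ) * X)) := by ring
    rw [e]
    refine (padicNorm.nonarchimedean (p := p)).trans (max_le (hW.trans ?_) ?_)
    · exact zpow_le_zpow_right₀ (by exact_mod_cast hp.out.one_lt.le) (by norm_num)
    · rw [padicNorm.neg, padicNorm.mul, hpn1]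
      calc _ ≤ (p : ℚ) ^ (-(1 : ℤ)) * 1 := mul_le_mul_of_nonneg_left hX1 (zpow_p_nonneg _)
        _ = _ := mul_one _
  · have e : v - AV = (v - AV + (p : ℚ) * Y) + (-((p : ℚ) * Y)) := by ring
    rw [e]
    refine (padicNorm.nonarchimedean (p := p)).trans (max_le (hV.trans ?_) ?_)
    · exact zpow_le_zpow_right₀ (by exact_mod_cast hp.out.one_lt.le) (by norm_num)
    · rw [padicNorm.neg, padicNorm.mul, hpn1]
      calc _ ≤ (p : ℚ) ^ (-(1 : ℤ)) * 1 := mul_le_mul_of_nonneg_left hY1 (zpow_p_nonneg _)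
        _ = _ := mul_one _
  · -- `‖u₁e₂ − u₂e₁‖ ≤ p⁻²`
    have e : (u.1 : ℚ) * (v - AV) - (u.2 : ℚ) * (w - AW)
        = ((u.1 : ℚ) * (v - AV + (p : ℚ) * Y) - (u.2 : ℚ) * (w - AW + (p : ℚ) * X))
          + (-((p : ℚ) * ((u.1 : ℚ) * Y - (u.2 : ℚ) * X))) := by ring
    rw [e]
    refine (padicNorm.nonarchimedean (p := p)).trans (max_le ((padicNorm.sub (p := p)).trans (max_le ?_ ?_)) ?_)
    · rw [padicNorm.mul]
      calc _ ≤ (1 : ℚ) * (p : ℚ) ^ (-(2 : ℤ)) := mul_le_mul hu1 hV (padicNorm.nonneg _) zero_le_one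
        _ = _ := one_mul _
    · rw [padicNorm.mul]
      calc _ ≤ (1 : ℚ) * (p : ℚ) ^ (-(2 : ℤ)) := mul_le_mul hu2 hW (padicNorm.nonneg _) zero_le_one
        _ = _ := one_mul _
    · rw [padicNorm.neg, padicNorm.mul, hpn1]
      calc _ ≤ (p : ℚ) ^ (-(1 : ℤ)) * (p : ℚ) ^ (-(1 : ℤ)) := mul_le_mul_of_nonneg_left hXY (zpow_p_nonneg _)
        _ = (p : ℚ) ^ (-(2 : ℤ)) := by rw [← zpow_add₀ hp0]; norm_num

omit hj7 in
/-- **TYPE-SPACE LAW, ORIGIN REGIME, two-sided conditional form**: class hypotheses on `b`, residue congruences and point parallelism for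
`b` and `b + e_j` ⟹ `v_p(Cas_j(b)) ≥ 5 − 2M`. -/
theorem typeSpaceLawOrigin_of_residues₂
    (HD : ∀ x ∈ liveClasses b p M, ∀ y ∈ liveClasses b p M, dirDet b p M u x y = 0 ∨ 1 ≤ padicValRat p (dirDet b p M u x y))
    (HD' : ∀ x ∈ liveClasses (shift b j) p M, ∀ y ∈ liveClasses (shift b j) p M,
      dirDet (shift b j) p M u x y = 0 ∨ 1 ≤ padicValRat p (dirDet (shift b j) p M u x y))
    (hres : padicNorm p
      ((∑ z ∈ (range p).filter (fun x => 1 ≤ classPoleCount b p x ∧ classExp b p x = -(M : ℤ)), gHat b p z * phiHat b p z)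
        + ∑ z ∈ (range p).filter (fun x => 1 ≤ classPoleCount b p x ∧ classExp b p x = -(M : ℤ) + 1), gHat b p z)
      ≤ (p : ℚ) ^ (-(1 : ℤ)))
    (hres' : padicNorm p
      ((∑ z ∈ (range p).filter (fun x => 1 ≤ classPoleCount (shift b j) p x ∧ classExp (shift b j) p x = -(M : ℤ)),
          gHat (shift b j) p z * phiHat (shift b j) p z)
        + ∑ z ∈ (range p).filter (fun x => 1 ≤ classPoleCount (shift b j) p x ∧ classExp (shift b j) p x = -(M : ℤ) + 1),
          gHat (shift b j) p z)
      ≤ (p : ℚ) ^ (-(1 : ℤ)))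
    (hcas : casoratian b j ≠ 0) : (5 : ℤ) - 2 * M ≤ padicValRat p (casoratian b j) := by
  have hp0 : (p : ℚ) ≠ 0 := Nat.cast_ne_zero.2 hp.out.ne_zero
  have hpneg : (-(p : ℚ)) ≠ 0 := neg_ne_zero.2 hp0
  have h0 : 0 ≤ b 0 := hb.1.1
  have h0' : 0 ≤ shift b j 0 := by rw [shift_zero b hj1]; exact h0
  have hpb' : (p : ℤ) ≤ shift b j 0 := by rw [shift_zero b hj1]; exact hpb
  have hwin' : (shift b j 0 + 2 : ℤ) < (p : ℤ) ^ 2 := by rw [shift_zero b hj1]; exact hwin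
  -- the class hypotheses transport to `b + e_j`
  have G1' := G1_shift b hb hj1 G1
  have G3o' : ∀ x, x < p → 1 ≤ classPoleCount (shift b j) p x → classExp (shift b j) p x = -(M : ℤ) →
      ¬ CentreIn (shift b j) p x ∧
      (u.1 : ℚ) * (vHat (shift b j) p x - vHat (shift b j) p (conjClass (shift b j) p x))
        - (u.2 : ℚ) * (wHat (shift b j) p x - wHat (shift b j) p (conjClass (shift b j) p x)) = 0 := by
    intro x hx h1 hE
    have h1b : 1 ≤ classPoleCount b p x := le_trans h1 (classPoleCount_shift_le b hb.1 hj1 p x)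
    have hEb := G1 x hx h1b
    have hge := classExp_shift_ge b hb.1 hj1 p x
    have heq : classExp (shift b j) p x = classExp b p x := by omega
    obtain ⟨hc, hparx⟩ := G3o x hx h1b (by omega)
    have hxn : x ≤ (b 0).toNat := le_b0_of_lt b hpb hx
    have hxn' : x ≤ (shift b j 0).toNat := by rw [shift_zero b hj1]; exact hxn
    have hcs : conjClass (shift b j) p x = conjClass b p x := by unfold conjClass; rw [shift_zero b hj1]
    have heqc : classExp (shift b j) p (conjClass b p x) = classExp b p (conjClass b p x) := by
      rw [← hcs, classExp_conj (shift b j) h0' hxn', hcs, classExp_conj b h0 hxn, heq]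
    refine ⟨fun h => hc ((centreIn_shift b hj1 p x).1 h), ?_⟩
    rw [hcs, wHat_shift_of_classExp_eq b hb.1 hj1 heq, wHat_shift_of_classExp_eq b hb.1 hj1 heqc,
      vHat_shift_of_classExp_eq b hb.1 hj1 heq, vHat_shift_of_classExp_eq b hb.1 hj1 heqc]
    exact hparx
  obtain ⟨α, e₁, e₂, hα, he₁, he₂, hd, hwE, hvE⟩ :=
    origin_decomposition hp5 hM hMe u hu b hb hpb hwin G1 G3o HD hres
  obtain ⟨α', e₁', e₂', hα', he₁', he₂', hd', hwE', hvE'⟩ :=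
    origin_decomposition hp5 hM hMe u hu (shift b j) hb' hpb' hwin' G1' G3o' HD' hres'
  have hdet := det_parallel_small hα hα' he₁ he₂ he₁' he₂' hd hd'
  have hcasE : casoratian b j = (-(p : ℚ)) ^ (-(M : ℤ) + 3) * (-(p : ℚ)) ^ (-(M : ℤ)) *
      ((α' * u.1 + e₁') * (α * u.2 + e₂) - (α * u.1 + e₁) * (α' * u.2 + e₂')) := by
    rw [← hwE, ← hvE, ← hwE', ← hvE']
    unfold casoratian
    field_simp
  apply val_ge_of_padicNorm_le hcas
  rw [hcasE, padicNorm.mul, padicNorm.mul, LevelClass.padicNorm_neg_p_zpow, LevelClass.padicNorm_neg_p_zpow]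
  calc (p : ℚ) ^ (-(-(M : ℤ) + 3)) * (p : ℚ) ^ (-(-(M : ℤ))) *
        padicNorm p ((α' * u.1 + e₁') * (α * u.2 + e₂) - (α * u.1 + e₁) * (α' * u.2 + e₂'))
      ≤ (p : ℚ) ^ (-(-(M : ℤ) + 3)) * (p : ℚ) ^ (-(-(M : ℤ))) * (p : ℚ) ^ (-(2 : ℤ)) :=
        mul_le_mul_of_nonneg_left hdet (mul_nonneg (zpow_p_nonneg _) (zpow_p_nonneg _))
    _ = (p : ℚ) ^ (-((5 : ℤ) - 2 * M)) := by
        rw [← zpow_add₀ hp0, ← zpow_add₀ hp0]; congr 1; ring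

/-- **TYPE-SPACE LAW, ORIGIN REGIME, two-sided (DEG form)**: as `ResidueLaw.TypeSpaceLawOrigin`, with the parallelism of the point
differences assumed for `b` and for `b + e_j`; the residue congruences come from THEOREM R via DEG. -/
theorem typeSpaceLawOrigin_twoSided
    (hdeg : (p : ℤ) * ((M : ℤ) - 2) + ∑ x ∈ range p, classExp b p x ≤ -4)
    (HD : ∀ x ∈ liveClasses b p M, ∀ y ∈ liveClasses b p M, dirDet b p M u x y = 0 ∨ 1 ≤ padicValRat p (dirDet b p M u x y))
    (HD' : ∀ x ∈ liveClasses (shift b j) p M, ∀ y ∈ liveClasses (shift b j) p M,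
      dirDet (shift b j) p M u x y = 0 ∨ 1 ≤ padicValRat p (dirDet (shift b j) p M u x y))
    (hcas : casoratian b j ≠ 0) : (5 : ℤ) - 2 * M ≤ padicValRat p (casoratian b j) := by
  have hdegb : (p : ℤ) * ((M : ℤ) - 2) + ∑ x ∈ range p, classExp b p x ≤ -2 := by omega
  have hsum : ∑ x ∈ range p, classExp (shift b j) p x = ∑ x ∈ range p, classExp b p x + 2 := by
    rw [sum_classExp_range (shift b j) hb' hp5, sum_classExp_range b hb hp5, dOf_shift b hj1 hj7]
    ring
  have hdeg' : (p : ℤ) * ((M : ℤ) - 2) + ∑ x ∈ range p, classExp (shift b j) p x ≤ -2 := by omega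
  have hpb' : (p : ℤ) ≤ shift b j 0 := by rw [shift_zero b hj1]; exact hpb
  exact typeSpaceLawOrigin_of_residues₂ b hb hb' hj1 hp5 hpb hwin hM hMe u hu G1 G3o HD HD'
    (res0_padicNorm_le b M hb hp5 hpb (by omega) G1 hdegb)
    (res0_padicNorm_le (shift b j) M hb' hp5 hpb' (by omega) (G1_shift b hb hj1 G1) hdeg') hcas

end Origin

end Summit.KontsevichZagierPeriods.Zeta5Search.SecondOrder
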